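import Summits.BirchSwinnertonDyer.BirchSwinnertonDyer.Theorems.KolyvaginRankRigidityAtTwoKolyvaginCorankLowerBoundAtTwoRichOfProp37
import Summits.BirchSwinnertonDyer.BirchSwinnertonDyer.Theorems.KolyvaginRankRigidityAtTwoFullClassDeepeningAtTwoOfProp37
import Summits.BirchSwinnertonDyer.BirchSwinnertonDyer.Theorems.KolyvaginRankRigidityAtTwoStrongNonzeroSystemOfSeedTransport
import Summits.BirchSwinnertonDyer.BirchSwinnertonDyer.Theorems.KolyvaginRankRigidityAtTwoNoTwoTorsionOverK
import Summits.BirchSwinnertonDyer.BirchSwinnertonDyer.Theorems.KolyvaginRankRigidityAtTwoSimpleZeroTwistSplitAtTwoOfBFH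
import HarnessLib

/-!
# Route `KolyvaginRankRigidityAtTwo` — THE LEAF FROM TWO OPEN INPUTS: Kolyvagin's Conjecture A at 2 (U1) and
# Gross 1991 Prop. 3.7 (2) (print), plus the printed inputs and the off-habitat residual (terminal by-name assembly, LEAD g9)

`nonCMTwoConverse_of_conjA_of_prop37` — the S3 leaf `Rank1Residual.NonCMTwoConverse` (the 2-converse
`corank_{ℤ₂} Sel_{2^∞}(E/ℚ) = r ⇒ ord_{s=1} L(E,s) = r`, `r ≤ 1`, for non-CM `E/ℚ` good-ordinary or multiplicative at `2`)
from EXACTLY: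
* `hU1 : KolyvaginBoundedDefectAtTwo` (stmt-28083, crux) — Kolyvagin's Conjecture A at `2` in bounded-defect form on the
  surjective-`2`-adic Heegner habitat (OPEN on `y_K`-torsion frames; nothing in print at `2`);
* `h37 : GrossLMS1991.prop37_2_frobeniusCongruence` (stmt-23091, print) — Gross 1991 Prop. 3.7 (2) = Nekovář 2007 Prop. 4.9,
  the Eichler–Shimura congruence for Heegner points (PUBLISHED; cite-only in the tree: no integral `X_0(N)` yet);
* the residual `hR : OffHabitatNonSurjTwoConverse` (stmt-24303: curves with non-surjective `2`-adic image), and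
* the printed inputs `hIn` (23951), `hf` (25006 BFH), `hGZK` (19921), `hMod` (19382 modularity), `hHLT` (19372), `hEnt` (19273);
everything else of the route's deciding theorem `closes` being DISCHARGED by landed theorems: V1′∞ `KolyvaginStrongNonzeroSystemAtTwo`
:= `strongNonzeroSystemOfSeedTransport_proof hU1 (fullClassDeepeningAtTwo_of_prop37 h37)` (glue 28085, pen; U2 28084 from Gross
3.7 (2), lead g8 p642176), V2♭∞ `KolyvaginCorankLowerBoundAtTwoRich` := `KolyvaginCorankLowerBoundAtTwoRich_of_prop37 h37` (lead g8
p641767 = krr2-p2 p640119 ∘ lead S1L p640628), `NoTwoTorsionOverK` := `noTwoTorsionOverK_proof` (23952),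
`SimpleZeroTwistSplitAtTwoOfBFH` := `simpleZeroTwistSplitAtTwoOfBFH_proof` (25007).
READING: at `p = 2` this is Kolyvagin's 1991 «Conjecture A ⇒ structure theorem ⇒ rank» chain (Math. Ann. 291 §2, printed for
odd `ℓ ∉ B(E)`; W. Zhang 2014 / BCGS 2026 for `p ≥ 5`) assembled in the kernel on the surjective-`2`-adic habitat, with the lossy
prime swap replacing Kolyvagin's prime exchange; the only non-print open input is Conjecture A at `2`.
HONEST FRAMING: CONDITIONAL theorem (hypotheses = route items / named facts, D-0014); nothing here closes U1, 23091, the residual or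
the printed inputs; the leaf is NOT proved; the Birch–Swinnerton-Dyer conjecture is NOT proved by this. `--supports` 28083.
References: [cite: Kolyvagin1991MathAnn, §2 Conj. A, Thm. 2.2–2.3] [cite: GrossLMS1991, Prop. 3.7 (2)] [cite: WZhang2014, Thm. 1.1]
[cite: GrossZagier1986, I (6.1)] [cite: BumpFriedbergHoffstein1990, Thm. (i)].
-/

set_option autoImplicit false
-- the Theorems namespace of this sub repeats the summit name by design (D-0017 nested layout)
set_option linter.dupNamespace false

noncomputable section

open Summit.BirchSwinnertonDyer.BirchSwinnertonDyer.Theses.KolyvaginRankRigidityAtTwo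
open Literature.NumberTheory.EllipticCurves.GrossLMS1991 (prop37_2_frobeniusCongruence)

namespace Summit.BirchSwinnertonDyer.BirchSwinnertonDyer.Theorems.KolyvaginLowerBoundAtTwo

/-- **The S3 leaf `NonCMTwoConverse` from Conjecture A at 2, Gross 3.7 (2), the off-habitat residual and the printed inputs**
(terminal by-name assembly of route `KolyvaginRankRigidityAtTwo`: its deciding theorem `closes` with V1′∞, V2♭∞, `NoTwoTorsionOverK`
and `SimpleZeroTwistSplitAtTwoOfBFH` discharged by landed theorems). CONDITIONAL; BSD is not proved by this.
[cite: Kolyvagin1991MathAnn, §2 Conj. A, Thm. 2.2–2.3] [cite: GrossLMS1991, Prop. 3.7 (2)] [cite: WZhang2014, Thm. 1.1] -/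
theorem nonCMTwoConverse_of_conjA_of_prop37 (hU1 : KolyvaginBoundedDefectAtTwo) (h37 : prop37_2_frobeniusCongruence)
    (hR : OffHabitatNonSurjTwoConverse) (hIn : PrintedInputsRankOneAtTwo) (hf : BFHTwistSupply)
    (hGZK : MultPublishedInputsAtTwo) (hMod : NewformOfEllipticCurve) (hHLT : HoffsteinLuoNonvanishingTwist)
    (hEnt : EntireLFunctionRat) :
    Summit.BirchSwinnertonDyer.BirchSwinnertonDyer.Rank1Residual.NonCMTwoConverse :=
  closes (KolyvaginRigidity.strongNonzeroSystemOfSeedTransport_proof hU1 (fullClassDeepeningAtTwo_of_prop37 h37))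
    (KolyvaginCorankLowerBoundAtTwoRich_of_prop37 h37) hR hIn KolyvaginRankRigidity.noTwoTorsionOverK_proof hf
    Theorems.simpleZeroTwistSplitAtTwoOfBFH_proof hGZK hMod hHLT hEnt

end Summit.BirchSwinnertonDyer.BirchSwinnertonDyer.Theorems.KolyvaginLowerBoundAtTwo

end
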